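import Summits.QuantumFields.YangMills.Theorems.BalabanUVNodesK0Stub1FlatChartDTransposeLetterAtRecord
import Summits.QuantumFields.YangMills.Theorems.BalabanUVNodesK0Stub1FlatChartSlN
import HarnessLib

/-!
# K0⁷ STUB 1-G (`stub_prop8StepCoPG13`, skeleton V20-G), sub-target S4b ♭ road — **(β2) AT THE RECORD, HERM0 EDITION: THE IMPLICIT ♭ CHART `Dsel♭` WITH ALL OF (β1)'s LETTERS
# AND THE REALITY THREAD AT THE SOURCE** — p631222 `exists_chartDFlat_himp_T4` verbatim + «Hermitian-traceless `A′` ⇒ `Dsel♭ A′`, `A′ − H·Dsel♭ A′` Hermitian traceless» on the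
# SAME `Dsel`, `ε` shrunk below the (0.4) winding guard

Cell `pub-ymgap`, width seat `pub-ymgap-k0-s1-w4` g2 (CLAIM-8 = k0-s1-w2 g6's ASK «OFFER-8 accepted in reshaped form», bus 2026-08-28T13:44Z ∕ 13:5xZ).
`--kind proof --supports stmt-QuantumFields-20541 --as helper`; count-neutral.  [15] = [Balaban1985Variational]; [B7] = [Balaban1985Averaging]; [I] = [Balaban1987RG1].

WHY.  k0-s1-w2's C″ (p633312) ∕ D″ (p636369) instantiate the Sect. F W-slot Socket at instance (S) with the implicit chart of p631222, but display for the ∃-bound `Dsel` only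
(55)♭ with an ∃-bound constant, `ContDiffOn ℂ ω`, (49)♭∕(48)♭ — not the `4C₂♭ε²` ball bound, so the reality engines (p633473 ∕ p634823 ∕ p635684) cannot be applied to THAT
`Dsel` downstream («scale-invariant obstruction `C_D ≤ 4C₂♭`»).  The reality of Sect. F's ♭ current (`herm_of_certificate`'s `hreal`; k0-s1-w1's `U t ∈ SU(N)` reading of
`e^{iη·chart♭}`) must therefore be threaded AT THE SOURCE: this file re-runs p631222's construction with one more conjunct and a radius below the winding guard.

WHAT IS PROVED (sorry-free; no definition; axioms standard).  ★★★ `exists_chartDFlat_himp_herm0_T4 (N) [NeZero N] (F : T4Family)` — the statement of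
`K0Stub1FlatChartDTransposeLetterAtRecord.exists_chartDFlat_himp_T4` with, inside the `∃ Dsel` block and right after the (49)♭ ∧ (48)♭ clause, the conjunct
`∀ A′, (∀ b, w 1 b·‖A′ b‖ < ε) → (∀ b, A′ b ∈ herm0 (Fin N)) → (∀ i, Dsel A′ i ∈ herm0 (Fin N)) ∧ ∀ b, (A′ − H (Dsel A′)) b ∈ herm0 (Fin N)`.
Proof: p631222's body with `ε := min (p631222's ε) (δ_N ∕ (64ℓL))`, and p635684 `chartDFlat_valued_herm0` (`θ := δ_N∕2`) on `flatChartDSocket`'s `Dsel`.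
HONEST SCOPE.  A re-thread of kernel-checked rows; nothing of [15]∕[B7] asserted; the guard is `N`-dependent exactly as the tree's (0.4) guard is; `stub_prop8StepCoPG13` ∕ K0⁷ NOT
closed; N07 NOT discharged; no summit statement is proved by this seat; counts unmoved (28∕28 · 5∕27); one finite 𝕋⁴ programme at fixed ε — R4 closes the conditional finite-𝕋⁴
rung only; the YM mass gap (Clay) is NOT proved by any of this.  No `sorry`, no `def`, no `instance`, no `notation`.

References: [15] (45)–(49) pp.285–286, (55)–(57) p.286, (66) p.288, (72)–(73) p.289, (152) p.301, (157) p.302; [B7] (23) p.21, Prop. 4 (134)–(135) p.38; [I] (0.1) p.251,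
(0.4)–(0.9) p.253.
-/

set_option autoImplicit false

noncomputable section

open scoped BigOperators Matrix.Norms.L2Operator Topology ContDiff
open NormedSpace Metric Set Filter

namespace Summit.QuantumFields.YangMills.Theorems.K0Stub1FlatChartDTransposeLetterAtRecordHerm0

open Literature.MathematicalPhysics.QuantumFieldTheory.Balaban1983to89
open ExpMeanLog (deltaSU deltaSU_pos)
open B9AdOrthogonal (herm0)
open Summit.QuantumFields.YangMills.Theorems.K0Stub1FlatChartDTransposeLetter (himp_chartDFlat_P)
open Literature.MathematicalPhysics.QuantumFieldTheory.Balaban1983to89.T4Continuum (T4Family)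
open B6SectADomainsV1 (Domains)
open B6SectAOperatorsV1 (BondIdx)
open B9Eq39Adjoint (bondPair)
open Summit.QuantumFields.YangMills.Theorems.FlatCubeOpsText (Adm22)
open Summit.QuantumFields.YangMills.Theorems.K0FlatCubeOpsTextP (IsLevWeight flatH)
open Summit.QuantumFields.YangMills.Theorems.Prop8ChartDoubleBar (chartLogFlat)
open Summit.QuantumFields.YangMills.Theorems.K0Stub1FlatChartDImplicit (flatChartDSocket fderiv_chartLogFlat_zero_rescaledFlatH)
open Summit.QuantumFields.YangMills.Theorems.K0Stub1FlatHRescaledRowsAtRecord (rescaledRows_of_adm22_T4)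
open Summit.QuantumFields.YangMills.Theorems.K0Stub1FlatChartSlN (chartDFlat_valued_herm0)
open Summit.QuantumFields.YangMills.BalabanUVNodes (N07ChartDOfRecord.exists_eps_chartD)
set_option maxHeartbeats 400000 in
/-- ★★★ **(β2) AT THE RECORD WITH THE REALITY THREAD AT THE SOURCE** — `exists_chartDFlat_himp_T4` (p631222) VERBATIM plus ONE conjunct on the Socket's own implicit chart
`Dsel♭`: for every bondwise Hermitian-traceless `A′` in the `ε`-ball, `Dsel♭ A′` and the dressed field `A′ − H·Dsel♭ A′` are bondwise Hermitian traceless (print's «`A` with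
values in 𝔤»).  The only change in the construction is the radius: `ε` is further shrunk below `δ_N∕(64ℓL)` so that CLAIM-6b's winding guard `32ℓLε ≤ δ_N∕2 < δ_N` holds
(`δ_N = min(1∕3, π∕N)`, the tree's (0.4) guard); the conjunct is p635684 `chartDFlat_valued_herm0` fed with the Socket's (55)♭ at `ρ′ := ε`, its (49)♭, and the REAL ♭ kernel
of `H` (`hH`).  Asked by k0-s1-w2 g6 (LOCATED-REALITY-THREAD, bus 2026-08-28T13:44Z): C″∕D″ hide `C_D` behind `∃`, so Hermitian-valuedness cannot be recovered downstream and
must travel with the chart from here (C‴∕D‴).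
[cite: Balaban1985Variational, (45)-(49) pp.285-286, (55)-(57) p.286, (66) p.288, (72)-(73) p.289, (152) p.301, (157) p.302; Balaban1985Averaging, (23) p.21, Prop. 4 p.38; Balaban1987RG1, (0.1) p.251, (0.4) p.253] -/
theorem exists_chartDFlat_himp_herm0_T4 (N : ℕ) [NeZero N] (F : T4Family) :
    ∃ (Mh₀ R₀ : ℕ) (Bf ε CD Θ : ℝ), 0 ≤ Bf ∧ 0 < ε ∧ 0 ≤ CD ∧ 0 ≤ Θ ∧
    ∀ (n K : ℕ) (_ : 1 ≤ K - n) (_ : K - n + 1 ≤ F.m + K) {Mh R a' : ℕ} (_ : Mh = F.L ^ a') (_ : Mh₀ ≤ Mh) (_ : R₀ ≤ R)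
      (_ : a' + 3 ≤ F.m + n) (D : Domains (F.P K)) (_ : D.k = K - n) (_ : Adm22 D R (F.L * Mh))
      (w : ℕ → PBond (F.P K) 0 → ℝ) (_ : IsLevWeight (F.P K) (K - n) D w)
      (H : (BondIdx D → Matrix (Fin N) (Fin N) ℂ) →ₗ[ℂ] (PBond (F.P K) 0 → Matrix (Fin N) (Fin N) ℂ))
      (_ : ∀ (X : BondIdx D → Matrix (Fin N) (Fin N) ℂ) (b : PBond (F.P K) 0), H X b =
        ∑ t, (((((F.P K).L : ℝ) ^ (t.1.1 : ℕ) * ((((F.P K).L : ℝ))⁻¹) ^ (K - n))⁻¹ * flatH (F.P K) (K - n) D (Pi.single t 1) b : ℝ) : ℂ) • X t),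
      (∀ (X : BondIdx D → Matrix (Fin N) (Fin N) ℂ) (t : ℝ), 0 ≤ t → (∀ c, ‖X c‖ ≤ t) → ∀ b, w 1 b * ‖H X b‖ ≤ Bf * t) ∧
      (∀ (X : BondIdx D → Matrix (Fin N) (Fin N) ℂ) (t : ℝ), 0 ≤ t → (∀ c, ‖X c‖ ≤ t) →
        ∀ (b : PBond (F.P K) 0) (ν : Fin (F.P K).d), w 2 b * ((F.P K).L : ℝ) ^ (K - n) * ‖H X ⟨b.src.shift ν, b.dir⟩ - H X b‖ ≤ Bf * t) ∧
      (∀ X, (fderiv ℂ (chartLogFlat ((((F.P K).L : ℝ)⁻¹) ^ (K - n)) D :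
          (PBond (F.P K) 0 → Matrix (Fin N) (Fin N) ℂ) → BondIdx D → Matrix (Fin N) (Fin N) ℂ) 0) (H X) = X) ∧
      ∃ Dsel : (PBond (F.P K) 0 → Matrix (Fin N) (Fin N) ℂ) → (BondIdx D → Matrix (Fin N) (Fin N) ℂ),
        (∀ A' : PBond (F.P K) 0 → Matrix (Fin N) (Fin N) ℂ, (∀ b, w 1 b * ‖A' b‖ < ε) →
          ∀ ρ' : ℝ, 0 ≤ ρ' → (∀ b, w 1 b * ‖A' b‖ ≤ ρ') → ∀ i : BondIdx D, ‖Dsel A' i‖ ≤ CD * ρ' ^ 2) ∧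
        ContDiffOn ℂ ω Dsel {Y : PBond (F.P K) 0 → Matrix (Fin N) (Fin N) ℂ | ∀ b, w 1 b * ‖Y b‖ < ε} ∧
        (∀ A' : PBond (F.P K) 0 → Matrix (Fin N) (Fin N) ℂ, (∀ b, w 1 b * ‖A' b‖ < ε) →
          chartLogFlat ((((F.P K).L : ℝ)⁻¹) ^ (K - n)) D (A' - H (Dsel A')) -
              (fderiv ℂ (chartLogFlat ((((F.P K).L : ℝ)⁻¹) ^ (K - n)) D :
                (PBond (F.P K) 0 → Matrix (Fin N) (Fin N) ℂ) → BondIdx D → Matrix (Fin N) (Fin N) ℂ) 0) (A' - H (Dsel A')) = Dsel A' ∧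
          chartLogFlat ((((F.P K).L : ℝ)⁻¹) ^ (K - n)) D (A' - H (Dsel A')) =
            (fderiv ℂ (chartLogFlat ((((F.P K).L : ℝ)⁻¹) ^ (K - n)) D :
              (PBond (F.P K) 0 → Matrix (Fin N) (Fin N) ℂ) → BondIdx D → Matrix (Fin N) (Fin N) ℂ) 0) A') ∧
        (∀ A' : PBond (F.P K) 0 → Matrix (Fin N) (Fin N) ℂ, (∀ b, w 1 b * ‖A' b‖ < ε) → (∀ b, A' b ∈ herm0 (Fin N)) →
          (∀ i, Dsel A' i ∈ herm0 (Fin N)) ∧ ∀ b, (A' - H (Dsel A')) b ∈ herm0 (Fin N)) ∧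
        ∀ (τ : Matrix (Fin N) (Fin N) ℂ →L[ℂ] ℂ) (ρ : (Matrix (Fin N) (Fin N) ℂ →L[ℂ] ℂ) →L[ℂ] Matrix (Fin N) (Fin N) ℂ)
          (_ : ∀ (ℓ' : Matrix (Fin N) (Fin N) ℂ →L[ℂ] ℂ) (X : Matrix (Fin N) (Fin N) ℂ), τ (ρ ℓ' * X) = ℓ' X)
          (_ : ∀ a b : Matrix (Fin N) (Fin N) ℂ, τ (a * b) = τ (b * a)) (_ : ∀ X : Matrix (Fin N) (Fin N) ℂ, ‖τ X‖ ≤ ‖X‖)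
          {Mρ : ℝ} (_ : 0 ≤ Mρ) (_ : ∀ ℓ' : Matrix (Fin N) (Fin N) ℂ →L[ℂ] ℂ, ‖ρ ℓ'‖ ≤ Mρ * ‖ℓ'‖)
          (BE : (PBond (F.P K) 0 → Matrix (Fin N) (Fin N) ℂ) →L[ℂ] (PBond (F.P K) 0 → Matrix (Fin N) (Fin N) ℂ) →L[ℂ] ℂ)
          (_ : ∀ Y δ : PBond (F.P K) 0 → Matrix (Fin N) (Fin N) ℂ, BE Y δ =
            bondPair ((((F.P K).L : ℝ))⁻¹ ^ (K - n)) (F.P K).d (τ : Matrix (Fin N) (Fin N) ℂ →ₗ[ℂ] ℂ) (fun μ x => Y ⟨x, μ⟩) (fun μ x => δ ⟨x, μ⟩))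
          (B : (BondIdx D → Matrix (Fin N) (Fin N) ℂ) →L[ℂ] (BondIdx D → Matrix (Fin N) (Fin N) ℂ) →L[ℂ] ℂ)
          (_ : ∀ X X' : BondIdx D → Matrix (Fin N) (Fin N) ℂ, B X X' = ∑ t, τ (X t * X' t)),
          ∀ (A' : PBond (F.P K) 0 → Matrix (Fin N) (Fin N) ℂ) (r : ℝ), (∀ b, w 1 b * ‖A' b‖ ≤ r) →
            (∀ (b : PBond (F.P K) 0) (ν : Fin (F.P K).d), w 2 b * ((F.P K).L : ℝ) ^ (K - n) * ‖A' ⟨b.src.shift ν, b.dir⟩ - A' b‖ ≤ r) → r < ε →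
            ∃ (C' : (PBond (F.P K) 0 → Matrix (Fin N) (Fin N) ℂ) →L[ℂ] (BondIdx D → Matrix (Fin N) (Fin N) ℂ))
              (Ct : (BondIdx D → Matrix (Fin N) (Fin N) ℂ) →L[ℂ] (PBond (F.P K) 0 → Matrix (Fin N) (Fin N) ℂ)),
              (∀ δ, fderiv ℂ Dsel A' δ = C' (δ - H (fderiv ℂ Dsel A' δ))) ∧
              (∀ X δ, BE (Ct X) δ = B X (C' δ)) ∧
              ∀ (X : BondIdx D → Matrix (Fin N) (Fin N) ℂ) (s : ℝ), (∀ t, (1 : ℝ) * ‖X t‖ ≤ s) →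
                ∀ b, w 3 b * ‖Ct X b‖ ≤ (Θ * Mρ) * r * s := by
  classical
  obtain ⟨Mh₁, R₁, Bf, hBf, hrows⟩ := rescaledRows_of_adm22_T4 F
  have hL1 : (1 : ℝ) ≤ F.L := by exact_mod_cast F.hL.2.le
  have hL12 : (12 : ℝ) ≤ F.L := by exact_mod_cast F.hL11
  have hL0 : (0 : ℝ) < (F.L : ℝ) := by linarith
  -- the k-uniform constants of the ♭ remainder (functions of `L`), made opaque after their positivity facts
  obtain ⟨ℓr, hℓr⟩ : ∃ ℓr : ℝ, ℓr = ((((4 : ℕ) + 2) * F.L : ℕ) : ℝ) := ⟨_, rfl⟩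
  have hℓ1 : (1 : ℝ) ≤ ℓr := by
    rw [hℓr]; exact_mod_cast Nat.one_le_iff_ne_zero.mpr (Nat.mul_ne_zero (by omega) (by have := F.hL.2; omega))
  obtain ⟨Rs, hRs⟩ : ∃ Rs : ℝ, Rs = (60800 * ℓr ^ 2 * (F.L : ℝ))⁻¹ := ⟨_, rfl⟩
  have hRs0 : 0 < Rs := by rw [hRs]; positivity
  obtain ⟨C₂, hC₂⟩ : ∃ C₂ : ℝ, C₂ = 64 * (F.L : ℝ) / Rs := ⟨_, rfl⟩
  have hC₂0 : 0 ≤ C₂ := by rw [hC₂]; exact div_nonneg (by positivity) hRs0.le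
  obtain ⟨A3, hA3⟩ : ∃ A3 : ℝ, A3 = (2560 * ℓr / (400 * ℓr)⁻¹) * (2 * ((4 : ℕ) : ℝ)) / ((F.L : ℝ) ^ 2 * ((F.L : ℝ) ^ (4 : ℕ))⁻¹) := ⟨_, rfl⟩
  have hA3nn : 0 ≤ A3 := by rw [hA3]; positivity
  have hdenΘ : 0 < 1 - 2 / (F.L : ℝ) - 1 / 12 := by
    have : 2 / (F.L : ℝ) ≤ 2 / 12 := div_le_div_of_nonneg_left (by norm_num) (by norm_num) hL12
    linarith
  obtain ⟨Θfl, hΘfl⟩ : ∃ Θfl : ℝ, Θfl = 16 * A3 * (F.L : ℝ) / (1 - 2 / (F.L : ℝ) - 1 / 12) := ⟨_, rfl⟩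
  have hΘfl0 : 0 ≤ Θfl := by rw [hΘfl]; exact div_nonneg (by positivity) hdenΘ.le
  -- the radius: α's window and p627481's four windows at `2ε`
  obtain ⟨ε₁, hε₁, hq₁, h3ε₁⟩ := N07ChartDOfRecord.exists_eps_chartD hC₂0 hBf (by positivity : 0 < Rs / 4)
  obtain ⟨A1, hA1⟩ : ∃ A1 : ℝ, A1 = 121600 * ℓr ^ 2 * (F.L : ℝ) := ⟨_, rfl⟩
  have hA1nn : 0 ≤ A1 := by rw [hA1]; positivity
  obtain ⟨W, hW⟩ : ∃ W : ℝ, W = 2 * A1 + 12 * 16 * (F.L : ℝ) * 2 * (A3 + 1) + 40 * (F.L : ℝ) := ⟨_, rfl⟩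
  have hW0 : 0 < W := by rw [hW]; positivity
  -- the winding guard of the (0.4) series logarithm: `32ℓLε ≤ δ_N∕2 < δ_N` (the ONE change w.r.t. `exists_chartDFlat_himp_T4`)
  have hδ : 0 < deltaSU (Fin N) := deltaSU_pos
  obtain ⟨ε, hεdef⟩ : ∃ ε : ℝ, ε = min (min ε₁ (1 / (W + 1))) (deltaSU (Fin N) / (64 * ℓr * (F.L : ℝ))) := ⟨_, rfl⟩
  have hεpos : 0 < ε := by rw [hεdef]; exact lt_min (lt_min hε₁ (by positivity)) (by positivity)
  have hεε₁ : ε ≤ ε₁ := by rw [hεdef]; exact (min_le_left _ _).trans (min_le_left _ _)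
  have hεW : ε * (W + 1) ≤ 1 := by
    have h : ε ≤ 1 / (W + 1) := by rw [hεdef]; exact (min_le_left _ _).trans (min_le_right _ _)
    rwa [le_div_iff₀ (by positivity)] at h
  have hguard' : 32 * ℓr * (F.L : ℝ) * ε ≤ deltaSU (Fin N) / 2 := by
    have h : ε ≤ deltaSU (Fin N) / (64 * ℓr * (F.L : ℝ)) := by rw [hεdef]; exact min_le_right _ _
    rw [le_div_iff₀ (by positivity)] at h
    linarith
  have hθ : deltaSU (Fin N) / 2 < deltaSU (Fin N) := by linarith
  -- the four windows at `2ε` and α's window, in the letters `ℓr, A3, C₂, Rs`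
  have hA1' : A1 * (2 * ε) ≤ 1 := by
    have h1 : 2 * A1 ≤ W + 1 := by rw [hW]; nlinarith
    calc A1 * (2 * ε) = ε * (2 * A1) := by ring
      _ ≤ ε * (W + 1) := mul_le_mul_of_nonneg_left h1 hεpos.le
      _ ≤ 1 := hεW
  have hA2' : 51200 * ℓr * (F.L : ℝ) * (2 * ε) ≤ 1 := by
    have h1 : 51200 * ℓr * (F.L : ℝ) ≤ A1 := by rw [hA1]; nlinarith
    calc 51200 * ℓr * (F.L : ℝ) * (2 * ε) ≤ A1 * (2 * ε) := mul_le_mul_of_nonneg_right h1 (by positivity)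
      _ ≤ 1 := hA1'
  have hA3' : A3 * (16 * ((F.L : ℝ) * (2 * ε))) ≤ 1 / 12 := by
    have h1 : 12 * 16 * (F.L : ℝ) * 2 * (A3 + 1) ≤ W + 1 := by rw [hW]; nlinarith
    have h2 : 12 * 16 * (F.L : ℝ) * 2 * (A3 + 1) * ε ≤ 1 :=
      calc 12 * 16 * (F.L : ℝ) * 2 * (A3 + 1) * ε = ε * (12 * 16 * (F.L : ℝ) * 2 * (A3 + 1)) := by ring
        _ ≤ ε * (W + 1) := mul_le_mul_of_nonneg_left h1 hεpos.le
        _ ≤ 1 := hεW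
    have h3 : A3 * (16 * ((F.L : ℝ) * (2 * ε))) ≤ (A3 + 1) * (16 * ((F.L : ℝ) * (2 * ε))) :=
      mul_le_mul_of_nonneg_right (by linarith) (by positivity)
    have h4 : (A3 + 1) * (16 * ((F.L : ℝ) * (2 * ε))) = (12 * 16 * (F.L : ℝ) * 2 * (A3 + 1) * ε) / 12 := by ring
    rw [h4] at h3
    linarith
  have hA4' : (F.L : ℝ) * (2 * ε) ≤ 1 / 20 := by
    have h1 : 40 * (F.L : ℝ) ≤ W + 1 := by rw [hW]; nlinarith
    have h2 : 40 * (F.L : ℝ) * ε ≤ 1 :=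
      calc 40 * (F.L : ℝ) * ε = ε * (40 * (F.L : ℝ)) := by ring
        _ ≤ ε * (W + 1) := mul_le_mul_of_nonneg_left h1 hεpos.le
        _ ≤ 1 := hεW
    linarith
  have hq' : 9 * C₂ * Bf * ε < 1 := lt_of_le_of_lt (mul_le_mul_of_nonneg_left hεε₁ (by positivity)) hq₁
  have h3ε' : 3 * ε ≤ Rs / 4 := by linarith
  -- rewrite the windows into the record's expanded letters
  subst hA1
  rw [hC₂, hRs, hℓr] at hq'
  rw [hRs, hℓr] at h3ε'
  rw [hℓr] at hA2'
  rw [hA3, hℓr] at hA3'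
  rw [hℓr] at hA1'
  rw [hℓr] at hguard'
  refine ⟨Mh₁, max R₁ (2 * F.L), Bf, ε, 4 * C₂, 32 * Θfl, hBf, hεpos, by positivity, by positivity, ?_⟩
  intro n K hk1 hk' Mh R a' hMha hMh hR hsize D hDk hAdm w hw H hH
  have hR₁ : R₁ ≤ R := le_trans (le_max_left _ _) hR
  have hRL : 2 * (F.P K).L ≤ R := le_trans (le_max_right _ _) hR
  have hMh1 : 1 ≤ Mh := by rw [hMha]; exact Nat.one_le_pow _ _ (F.P K).L_pos
  have hM1 : 1 ≤ F.L * Mh := Nat.mul_pos (F.P K).L_pos (by omega)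
  -- (i) the rows at `ν_t := (L^{j(t)}η)⁻¹`
  have hν : ∀ t : BondIdx D, |(((F.P K).L : ℝ) ^ (t.1.1 : ℕ) * ((((F.P K).L : ℝ))⁻¹) ^ (K - n))⁻¹| ≤
      (((F.P K).L : ℝ) ^ (t.1.1 : ℕ) * ((((F.P K).L : ℝ))⁻¹) ^ (K - n))⁻¹ := fun t => by
    have : (0 : ℝ) < ((F.P K).L : ℝ) := by exact_mod_cast (F.P K).L_pos
    rw [abs_of_pos (by positivity)]
  obtain ⟨hHB, hHgrad⟩ := hrows n K hk1 hk' hMha hMh hR₁ hsize D hDk hAdm w hw (𝔸 := Matrix (Fin N) (Fin N) ℂ)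
    (fun t => (((F.P K).L : ℝ) ^ (t.1.1 : ℕ) * ((((F.P K).L : ℝ))⁻¹) ^ (K - n))⁻¹) hν H hH
  -- (ii) the right inverse
  have hinv := fderiv_chartLogFlat_zero_rescaledFlatH (k := K - n) (D := D) H hH
  refine ⟨hHB, hHgrad, hinv, ?_⟩
  -- (iii) the implicit chart at radius `ε` (FILE α)
  have hqα : 9 * (64 * ((F.P K).L : ℝ) / (60800 * ((((F.P K).d + 2) * (F.P K).L : ℕ) : ℝ) ^ 2 * ((F.P K).L : ℝ))⁻¹) * Bf * ε < 1 := by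
    simpa only [T4Family.P_L, T4Family.P_d] using hq'
  have h3εα : 3 * ε ≤ (60800 * ((((F.P K).d + 2) * (F.P K).L : ℕ) : ℝ) ^ 2 * ((F.P K).L : ℝ))⁻¹ / 4 := by
    simpa only [T4Family.P_L, T4Family.P_d] using h3ε'
  obtain ⟨Dsel, -, -, h55, hcd, hfix⟩ := flatChartDSocket (N := N) (k := K - n) (D := D) hRL hM1 hDk hAdm hw H hBf hHB hinv (ε := ε) hqα h3εα hεpos
  have h55' : ∀ A' : PBond (F.P K) 0 → Matrix (Fin N) (Fin N) ℂ, (∀ b, w 1 b * ‖A' b‖ < ε) →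
      ∀ ρ' : ℝ, 0 ≤ ρ' → (∀ b, w 1 b * ‖A' b‖ ≤ ρ') → ∀ i : BondIdx D, ‖Dsel A' i‖ ≤ (4 * C₂) * ρ' ^ 2 := by
    intro A' hA' ρ' hρ' hA'ρ i
    rw [hC₂, hRs, hℓr]
    simpa only [T4Family.P_L, T4Family.P_d] using h55 A' hA' ρ' hρ' hA'ρ i
  -- (iii′) the reality thread at the source: CLAIM-6b's value-module engine at `S := herm0` on the Socket's OWN `Dsel` (ball bound from (55)♭ at `ρ′ := ε`, (49)♭, the
  -- ♭ kernel of `H` is real), winding guard `32ℓLε ≤ δ_N∕2 < δ_N`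
  have hguardα : 32 * ((((F.P K).d + 2) * (F.P K).L : ℕ) : ℝ) * ((F.P K).L : ℝ) * ε ≤ deltaSU (Fin N) / 2 := by
    simpa only [T4Family.P_L, T4Family.P_d] using hguard'
  have hherm : ∀ A' : PBond (F.P K) 0 → Matrix (Fin N) (Fin N) ℂ, (∀ b, w 1 b * ‖A' b‖ < ε) → (∀ b, A' b ∈ herm0 (Fin N)) →
      (∀ i, Dsel A' i ∈ herm0 (Fin N)) ∧ ∀ b, (A' - H (Dsel A')) b ∈ herm0 (Fin N) := fun A' hA' hA'h =>
    chartDFlat_valued_herm0 (K - n) D hDk hAdm hRL hM1 hw H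
      (fun b t => (((F.P K).L : ℝ) ^ (t.1.1 : ℕ) * ((((F.P K).L : ℝ))⁻¹) ^ (K - n))⁻¹ * flatH (F.P K) (K - n) D (Pi.single t 1) b) hH hBf hHB hεpos hqα h3εα hθ
      hguardα Dsel (fun A'' hA'' i => h55 A'' hA'' ε hεpos.le (fun b => (hA'' b).le) i) (fun A'' hA'' => (hfix A'' hA'').1) hA' hA'h
  refine ⟨Dsel, h55', hcd, hfix, hherm, ?_⟩
  intro τ ρ hρ hτ hτ1 Mρ hMρ hρn BE hBE B hB A' r h0 h1 hr
  have hd : 4 ≤ (F.P K).d := by rw [T4Family.P_d]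
  have hwin1 : 121600 * ((((F.P K).d + 2) * (F.P K).L : ℕ) : ℝ) ^ 2 * ((F.P K).L : ℝ) * (2 * ε) ≤ 1 := by
    simpa only [T4Family.P_L, T4Family.P_d] using hA1'
  have hwin2 : 51200 * ((((F.P K).d + 2) * (F.P K).L : ℕ) : ℝ) * ((F.P K).L : ℝ) * (2 * ε) ≤ 1 := by
    simpa only [T4Family.P_L, T4Family.P_d] using hA2'
  have hwin3 : (2560 * ((((F.P K).d + 2) * (F.P K).L : ℕ) : ℝ) / (400 * ((((F.P K).d + 2) * (F.P K).L : ℕ) : ℝ))⁻¹) * (2 * ((F.P K).d : ℝ)) /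
        (((F.P K).L : ℝ) ^ 2 * (((F.P K).L : ℝ) ^ (F.P K).d)⁻¹) * (16 * (((F.P K).L : ℝ) * (2 * ε))) ≤ 1 / 12 := by
    simpa only [T4Family.P_L, T4Family.P_d] using hA3'
  have hwin4 : ((F.P K).L : ℝ) * (2 * ε) ≤ 1 / 20 := by simpa only [T4Family.P_L] using hA4'
  -- §1 at the record
  obtain ⟨C', Ct, himp1, himp2, hletter⟩ := himp_chartDFlat_P (N := N) hd (K - n) D hDk hAdm hRL hM1 hw τ ρ hρ hτ hτ1 hMρ hρn BE hBE B hB H hBf hHB hHgrad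
    Dsel hεpos hqα h3εα h55 (fun A'' hA'' => (hfix A'' hA'').1) hwin1 hwin2 hwin3 hwin4 A' r h0 h1 hr
  refine ⟨C', Ct, himp1, himp2, fun X s hX b => (hletter X s hX b).trans (le_of_eq ?_)⟩
  -- the constant: `2·Θ₀ = 32·Θ♭·M_ρ` at `d = 4`
  have hη0 : 0 < (((F.P K).L : ℝ)⁻¹) ^ (K - n) := by
    have : (0 : ℝ) < ((F.P K).L : ℝ) := by exact_mod_cast (F.P K).L_pos
    positivity
  rw [abs_of_pos hη0, hΘfl, hA3, hℓr]
  simp only [T4Family.P_L, T4Family.P_d]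
  -- the common Θ♭(L) factor is generalised away; what is left is `2·((η⁴)⁻¹·M_ρ·T·(4·4·η⁴)) = 32·T·M_ρ`
  generalize (16 * (2560 * ((((4 : ℕ) + 2) * F.L : ℕ) : ℝ) / (400 * ((((4 : ℕ) + 2) * F.L : ℕ) : ℝ))⁻¹ * (2 * ((4 : ℕ) : ℝ)) /
      ((F.L : ℝ) ^ 2 * ((F.L : ℝ) ^ 4)⁻¹)) * (F.L : ℝ) / (1 - 2 / (F.L : ℝ) - 1 / 12)) = T
  have hη4 : (((F.L : ℝ)⁻¹) ^ (K - n)) ^ 4 ≠ 0 := by positivity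
  push_cast
  field_simp
  ring

end Summit.QuantumFields.YangMills.Theorems.K0Stub1FlatChartDTransposeLetterAtRecordHerm0

end
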